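import Mathlib
import Summits.Ventures.DiscreteObjects.Mahler.SubLehmerStructure

/-!
# The height-1 sub-Lehmer census up to degree 60 as a finite union of cells
(venture `DiscreteObjects`, target L)

Cell `pub-namedobj`, seat `pub-namedobj-mahler` (gen 6). Framing: lottery ticket; floor = certified
bounds/negative ranges.

Kernel form of the cell decomposition behind the cell's height-1 census at degrees `56 … 60`
(EFFICIENCY-L6c §10; `SubLehmerDegree56/57/58`, `SubLehmerStructure`).  By `subLehmer_structure`
(conditional on the named facts [MRW08, Thm 1.1] and Smyth's theorem) a sub-Lehmer integer polynomial
`P` of degree `≤ 60` is `± x^a · Φ_{m₁}⋯Φ_{m_r} · Q` with `Q` an irreducible, reciprocal,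
cyclotomic-free "core" of degree `d ∈ {56, 58, 60}` and `a + Σ φ(m_i) + d = deg P`.  Since
`height (± x^a · R) = height R` (`height_signed_shift`), the statement

  "no integer polynomial of degree `≤ 60` and height `≤ 1` is sub-Lehmer"

follows from the finitely many CELL statements `Height1Cell s d` — "no irreducible reciprocal
cyclotomic-free `Q` of degree `d` with `height (Φ_s · Q) ≤ 1` is sub-Lehmer" — indexed by a multiset
`s` over `{1,2,3,4,5,6,8,10,12}` and `d ∈ {56,58,60}` with `Σ_{m ∈ s} φ(m) + d ≤ 60`
(`height1_subLehmer_empty_le_60_of_cells`, `heightBoundedCensus_le_60_of_cells`).  Each cell is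
exactly one "CORES" run (`s = ∅`) or one cyclotomic "offset" run of the census engines; the cell with
`s = ∅, d = 56` is implied by the typed L6 certificate statement `CyclotomicFreeHeight1Degree56SubLehmerEmpty`
(`height1Cell_zero_56_of_cyclotomicFree`).  The cells are TYPED here; they are decided by the
two-engine census, not proved in Lean.
-/

namespace Summit.Ventures.DiscreteObjects.Mahler

open Polynomial Literature.NumberTheory.MahlerMeasure

/-! ### The naive height under sign change and shift -/

/-- `height p ≤ h` iff every coefficient has absolute value `≤ h`. -/
theorem height_le_iff (p : ℤ[X]) (h : ℕ) : height p ≤ h ↔ ∀ i, (p.coeff i).natAbs ≤ h := by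
  unfold height
  rw [Finset.sup_le_iff]
  constructor
  · intro H i
    by_cases hi : i ∈ p.support
    · exact H i hi
    · rw [notMem_support_iff.mp hi]; simp
  · intro H i _
    exact H i

/-- The height is invariant under `p ↦ -p`. -/
theorem height_neg (p : ℤ[X]) : height (-p) = height p := by
  apply le_antisymm
  · rw [height_le_iff]; intro i; rw [coeff_neg, Int.natAbs_neg]; exact (height_le_iff p _).mp le_rfl i
  · rw [height_le_iff]; intro i
    have := (height_le_iff (-p) _).mp le_rfl i
    rwa [coeff_neg, Int.natAbs_neg] at this

/-- The height is invariant under multiplication by `x^a`. -/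
theorem height_X_pow_mul (a : ℕ) (p : ℤ[X]) : height (X ^ a * p) = height p := by
  apply le_antisymm
  · rw [height_le_iff]; intro i
    rw [coeff_X_pow_mul']
    split_ifs
    · exact (height_le_iff p _).mp le_rfl _
    · simp
  · rw [height_le_iff]; intro i
    have := (height_le_iff (X ^ a * p) _).mp le_rfl (i + a)
    rwa [coeff_X_pow_mul] at this

/-- The height is invariant under `R ↦ ± x^a · R`. -/
theorem height_signed_shift {u : ℤ} (hu : u = 1 ∨ u = -1) (a : ℕ) (R : ℤ[X]) :
    height (C u * X ^ a * R) = height R := by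
  rcases hu with rfl | rfl
  · rw [map_one, one_mul, height_X_pow_mul]
  · rw [map_neg, map_one, mul_assoc, neg_one_mul, height_neg, height_X_pow_mul]

/-! ### Cells -/

/-- **Cell statement** `(s, d)` of the height-1 sub-Lehmer census (TYPED; decided by the census
engines, not proved here): no IRREDUCIBLE, reciprocal, cyclotomic-free integer polynomial `Q` of degree
`d` with `Q(0) ≠ 0` and `height (Φ_s · Q) ≤ 1`, where `Φ_s := ∏_{m ∈ s} Φ_m`, is sub-Lehmer.
`s = ∅` is the "CORES(d)" run, `s ≠ ∅` an "offset" run (power sums of `Q` in certified boxes shifted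
by the power sums of `Φ_s`). -/
def Height1Cell (s : Multiset ℕ) (d : ℕ) : Prop :=
  ∀ Q : ℤ[X], Q.natDegree = d → Irreducible Q → Q.reverse = Q → Q.coeff 0 ≠ 0 →
    (∀ m : ℕ, 0 < m → ¬ cyclotomic m ℤ ∣ Q) →
    height ((s.map fun m => cyclotomic m ℤ).prod * Q) ≤ 1 → ¬ SubLehmer Q

/-- The admissible cell indices up to degree `60`: `s` a multiset over `{1,2,3,4,5,6,8,10,12}`,
`d ∈ {56, 58, 60}`, `Σ_{m ∈ s} φ(m) + d ≤ 60`. -/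
def AdmissibleCell (s : Multiset ℕ) (d : ℕ) : Prop :=
  (∀ m ∈ s, m ∈ ({1, 2, 3, 4, 5, 6, 8, 10, 12} : Finset ℕ)) ∧ (d = 56 ∨ d = 58 ∨ d = 60) ∧
    (s.map Nat.totient).sum + d ≤ 60

/-- **Assembly (kernel):** conditional on [MRW08, Thm 1.1] and Smyth's theorem, if every admissible
cell `(s, d)` is empty then no integer polynomial of degree `≤ 60` and height `≤ 1` is sub-Lehmer. -/
theorem height1_subLehmer_empty_le_60_of_cells (h : SubLehmerDegreeBound) (hS : NonreciprocalMahlerBound)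
    (hcells : ∀ (s : Multiset ℕ) (d : ℕ), AdmissibleCell s d → Height1Cell s d) :
    ∀ P : ℤ[X], P.natDegree ≤ 60 → height P ≤ 1 → ¬ SubLehmer P := by
  intro P hdeg hh hP
  obtain ⟨u, a, s, Q, hu, hs, hPf, hQirr, hQ, _, hrev, hQd, hc0, hncyc, hdegs, _⟩ :=
    subLehmer_degree_le_60_structure h hS hP hdeg
  have hadm : AdmissibleCell s Q.natDegree := ⟨hs, hQd, by omega⟩
  have hhR : height ((s.map fun m => cyclotomic m ℤ).prod * Q) ≤ 1 := by
    rw [← height_signed_shift hu a, ← mul_assoc, ← hPf]; exact hh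
  exact hcells s Q.natDegree hadm Q rfl hQirr hrev hc0 hncyc hhR hQ

/-- The same in the vocabulary of the census rows: every height-1 row `(n, 1, M(L))`, `n ≤ 60`, has
the EMPTY witness list. -/
theorem heightBoundedCensus_le_60_of_cells (h : SubLehmerDegreeBound) (hS : NonreciprocalMahlerBound)
    (hcells : ∀ (s : Multiset ℕ) (d : ℕ), AdmissibleCell s d → Height1Cell s d) {n : ℕ} (hn : n ≤ 60) :
    HeightBoundedCensus n 1 (intMahlerMeasure lehmerPoly) [] := by
  rw [heightBoundedCensus_nil_iff]
  intro p hdeg hh h1 hlt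
  exact height1_subLehmer_empty_le_60_of_cells h hS hcells p (by omega) hh ⟨h1, hlt⟩

/-- The L6 certificate statement (CORES run at degree `56`, typed in `SubLehmerDegree56`) is the cell
`(∅, 56)`. -/
theorem height1Cell_zero_56_of_cyclotomicFree (hcensus : CyclotomicFreeHeight1Degree56SubLehmerEmpty) :
    Height1Cell 0 56 := by
  intro Q hdeg _ _ _ hncyc hh
  rw [Multiset.map_zero, Multiset.prod_zero, one_mul] at hh
  exact hcensus Q hdeg hh hncyc

/-- Conversely, at degree `56` only the cell `(∅, 56)` is admissible-and-relevant: conditional on the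
named facts, `Height1Cell 0 56` gives the headline L6 statement `Height1Degree56SubLehmerEmpty`. -/
theorem height1Degree56SubLehmerEmpty_of_cell (h : SubLehmerDegreeBound) (hS : NonreciprocalMahlerBound)
    (hcell : Height1Cell 0 56) : Height1Degree56SubLehmerEmpty := by
  rw [height1Degree56SubLehmerEmpty_iff]
  intro P hdeg hh hP
  obtain ⟨u, a, s, Q, hu, hs, hPf, hQirr, hQ, _, hrev, hQd, hc0, hncyc, hdegs, _⟩ :=
    subLehmer_degree_le_60_structure h hS hP (by omega)
  -- degree bookkeeping forces a = 0, s = ∅ (every φ(m) ≥ 1), d = 56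
  have hsum0 : (s.map Nat.totient).sum = 0 := by omega
  have hs0 : s = 0 := by
    rcases Multiset.empty_or_exists_mem s with h0 | ⟨m, hm⟩
    · exact h0
    · exfalso
      have hmpos : 0 < m := by
        have := hs m hm
        simp only [Finset.mem_insert, Finset.mem_singleton] at this
        omega
      have hle : Nat.totient m ≤ (s.map Nat.totient).sum :=
        Multiset.le_sum_of_mem (Multiset.mem_map_of_mem Nat.totient hm)
      have := Nat.totient_pos.mpr hmpos
      omega
  subst hs0
  have hQ56 : Q.natDegree = 56 := by omega
  have hhR : height ((Multiset.map (fun m => cyclotomic m ℤ) 0).prod * Q) ≤ 1 := by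
    rw [← height_signed_shift hu a, ← mul_assoc, ← hPf]; exact hh
  exact hcell Q hQ56 hQirr hrev hc0 hncyc hhR hQ

end Summit.Ventures.DiscreteObjects.Mahler
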